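import Summits.FinalStateConjecture.FinalStateConjecture.Theorems.EIHFluxBalanceInertialRecessionStubCoerMomQuantVar
import Summits.FinalStateConjecture.FinalStateConjecture.Theorems.EIHFluxBalanceInertialRecessionSlavingFarFieldSpinSmooth

/-!
# Route EIHFluxBalance — `InertialRecession` (E′), line `SketchCleanExcision`, skeleton r13,
# stub `stub_coerMomKernel` (Bk), analytic half, part 4: REGULARITY of the far-field family in the
# parameters (mass scale and spin), and the spin derivative of the first-variation field

Helper file for the crux `stmt-FinalStateConjecture-17403`
(`Summit.FinalStateConjecture.FinalStateConjecture.Theses.EIHFluxBalance.InertialRecession`, E′),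
registered stub `stub_coerMomKernel` (Bk) of skeleton r13 (seat 1, analytic half of Bk).

The graded limit of Bk (part 5) needs the 2-jets at a lab point `x` of the painted summands
`K_ε(z) = g_{εM,εa}(Sz)(S·,S·)` and of the first-variation fields
`Var_{(M,a',A,d)}(z) = Dg_{M,a'}(Sz)(A(Sz)+d)(S·,S·) + g_{M,a'}(Sz)(AS·,S·) + g_{M,a'}(Sz)(S·,AS·)`
as regular functions of the parameters `ε` and `a'`:

* `bk_contDiffAt_family₂`, `bk_contDiffAt_var₂` — joint smoothness in (parameter, lab point)
  (`Kerr.contDiffAt_bilin₃`, parametric `ContDiffAt.fderiv`);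
* `bk_hasDerivAt_fderiv_partial` — **mixed partials**: for `Φ : ℝ × E → F` of class `C²`,
  `d/da|₀ D₂Φ(a, x) = D(∂_aΦ(0, ·))(x)` as an identity of `E →L F`-valued derivatives;
* `bk_hasDerivAt_fderiv_bilin_spin` — `∂_a Dg_{M,a}(p)|_{a=0} = D(∂_a g_{M,·})(p) = D(spinMetric M)(p)`;
* `bk_hasDerivAt_var_spin`, `bk_hasDerivAt_fderiv_var_spin` — **the spin derivative of the
  first-variation field and of its lab derivative is the first variation of the spin dipole**
  `spinVar_{(M,A,d)}(z) = D(spinMetric M)(Sz)(A(Sz)+d)(S·,S·) + spinMetric M(Sz)(AS·,S·) + …`;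
* `bk_contDiffAt_spinVar`, `bk_spinVar_symm` — the spin first-variation field is smooth with
  symmetric values off the painted time axis.

No definitions, no named facts, no `sorry`.
-/

set_option linter.dupNamespace false
set_option maxSynthPendingDepth 3

noncomputable section

open Set Function Filter ContinuousLinearMap Literature.Geometry.Lorentzian
  Literature.Geometry.Lorentzian.MetricCoord
open scoped Topology ContDiff

namespace Summit.FinalStateConjecture.FinalStateConjecture.Theorems.SublinearIsFree.Slaving

/-! ### Joint smoothness in the parameters -/

/-- **The scaled painted family is jointly smooth** in the scale `ε` and the lab point `z`:
`(ε, z) ↦ g_{εM, εa}(Sz)(S·, S·)` is `C^∞` at every `(ε₀, x)` with `r_{ε₀ a}(Sx) > 0`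
(`Kerr.contDiffAt_bilin₃`). [cite: KerrSchild1965, §3] -/
theorem bk_contDiffAt_family₂ (M a : ℝ) (S : E4 →L[ℝ] E4) {q₀ : ℝ × E4}
    (hq₀ : 0 < Kerr.radius (q₀.1 * a) (S q₀.2)) :
    ContDiffAt ℝ ∞ (fun q : ℝ × E4 ↦ (Kerr.bilin (q.1 * M) (q.1 * a) (S q.2)).bilinearComp S S) q₀ := by
  have hφ : ContDiffAt ℝ ∞ (fun q : ℝ × E4 ↦ ((q.1 * M, q.1 * a, S q.2) : ℝ × ℝ × E4)) q₀ :=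
    (contDiffAt_fst.mul contDiffAt_const).prodMk ((contDiffAt_fst.mul contDiffAt_const).prodMk
      (S.contDiff.contDiffAt.comp q₀ contDiffAt_snd))
  have hK : ContDiffAt ℝ ∞ (fun q : ℝ × E4 ↦ Kerr.bilin (q.1 * M) (q.1 * a) (S q.2)) q₀ :=
    ContDiffAt.comp (g := fun r : ℝ × ℝ × E4 ↦ Kerr.bilin r.1 r.2.1 r.2.2)
      (f := fun q : ℝ × E4 ↦ ((q.1 * M, q.1 * a, S q.2) : ℝ × ℝ × E4)) q₀
      (Kerr.contDiffAt_bilin₃ (q := ((q₀.1 * M, q₀.1 * a, S q₀.2) : ℝ × ℝ × E4)) hq₀) hφ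
  exact coerMomQ_contDiffAt_bilinearComp hK contDiffAt_const contDiffAt_const

/-- **The first-variation field is jointly smooth in the spin and the lab point**:
`(a', z) ↦ Var_{(M,a',A,d)}(z)` is `C^∞` at every `(a₀, x)` with `r_{a₀}(Sx) > 0`
(`LiMei.contDiffAt_bilin_spin₂`, parametric `ContDiffAt.fderiv`). [cite: KerrSchild1965, §3] -/
theorem bk_contDiffAt_var₂ (M : ℝ) (S A : E4 →L[ℝ] E4) (d : E4) {q₀ : ℝ × E4}
    (hq₀ : 0 < Kerr.radius q₀.1 (S q₀.2)) :
    ContDiffAt ℝ ∞ (fun q : ℝ × E4 ↦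
      (fderiv ℝ (Kerr.bilin M q.1) (S q.2) (A (S q.2) + d)).bilinearComp S S
        + (Kerr.bilin M q.1 (S q.2)).bilinearComp (A.comp S) S
        + (Kerr.bilin M q.1 (S q.2)).bilinearComp S (A.comp S)) q₀ := by
  have htop : (∞ : WithTop ℕ∞) + 1 ≤ ∞ := by simp
  have hSz : ContDiffAt ℝ ∞ (fun q : ℝ × E4 ↦ S q.2) q₀ := S.contDiff.contDiffAt.comp q₀ contDiffAt_snd
  have hK : ContDiffAt ℝ ∞ (fun q : ℝ × E4 ↦ Kerr.bilin M q.1 (S q.2)) q₀ :=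
    ContDiffAt.comp (g := fun r : ℝ × E4 ↦ Kerr.bilin M r.1 r.2)
      (f := fun q : ℝ × E4 ↦ ((q.1, S q.2) : ℝ × E4)) q₀
      (LiMei.contDiffAt_bilin_spin₂ M (q := ((q₀.1, S q₀.2) : ℝ × E4)) hq₀) (contDiffAt_fst.prodMk hSz)
  -- the parametric derivative `(a', z) ↦ Dg_{M,a'}(Sz)`
  have hf : ContDiffAt ℝ ∞ (uncurry fun (q : ℝ × E4) (p : E4) ↦ Kerr.bilin M q.1 p) (q₀, S q₀.2) := by
    have hr : ContDiffAt ℝ ∞ (fun r : (ℝ × E4) × E4 ↦ ((r.1.1, r.2) : ℝ × E4)) (q₀, S q₀.2) :=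
      (contDiffAt_fst.comp _ contDiffAt_fst).prodMk contDiffAt_snd
    exact ContDiffAt.comp (g := fun r : ℝ × E4 ↦ Kerr.bilin M r.1 r.2)
      (f := fun r : (ℝ × E4) × E4 ↦ ((r.1.1, r.2) : ℝ × E4)) (q₀, S q₀.2)
      (LiMei.contDiffAt_bilin_spin₂ M (q := ((q₀.1, S q₀.2) : ℝ × E4)) hq₀) hr
  have hDK : ContDiffAt ℝ ∞ (fun q : ℝ × E4 ↦ fderiv ℝ (Kerr.bilin M q.1) (S q.2)) q₀ :=
    ContDiffAt.fderiv (f := fun (q : ℝ × E4) (p : E4) ↦ Kerr.bilin M q.1 p) (g := fun q : ℝ × E4 ↦ S q.2)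
      hf hSz htop
  have hdir : ContDiffAt ℝ ∞ (fun q : ℝ × E4 ↦ A (S q.2) + d) q₀ :=
    (A.contDiff.contDiffAt.comp q₀ hSz).add contDiffAt_const
  exact ((coerMomQ_contDiffAt_bilinearComp (hDK.clm_apply hdir) contDiffAt_const contDiffAt_const).add
    (coerMomQ_contDiffAt_bilinearComp hK contDiffAt_const contDiffAt_const)).add
    (coerMomQ_contDiffAt_bilinearComp hK contDiffAt_const contDiffAt_const)

/-! ### Mixed partials -/

section MixedPartials

variable {E F : Type*} [NormedAddCommGroup E] [NormedSpace ℝ E] [NormedAddCommGroup F]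
  [NormedSpace ℝ F]

/-- **Mixed partials, operator form.** For `Φ : ℝ × E → F` of class `C²` at `(0, x₀)` whose
partial derivative in the scalar slot is the field `S'` near `x₀`
(`∂_a Φ(a, z)|_{a=0} = S'(z)`), the `E →L F`-valued map `a ↦ D(Φ(a, ·))(x₀)` has derivative
`D S'(x₀)` at `a = 0` (Schwarz's theorem, `ContDiffAt.isSymmSndFDerivAt`; cf.
`hasDerivAt_fderiv_curry_along₀` for the version applied to a vector). [folklore] -/
theorem bk_hasDerivAt_fderiv_partial {Φ : ℝ × E → F} {x₀ : E} {S' : E → F}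
    (hΦ : ContDiffAt ℝ 2 Φ (0, x₀)) (hS : ∀ᶠ z in 𝓝 x₀, HasDerivAt (fun a ↦ Φ (a, z)) (S' z) 0) :
    HasDerivAt (fun a ↦ fderiv ℝ (fun z ↦ Φ (a, z)) x₀) (fderiv ℝ S' x₀) 0 := by
  have hΦ' : ∀ᶠ q in 𝓝 ((0 : ℝ), x₀), ContDiffAt ℝ 2 Φ q := hΦ.eventually (by simp)
  have hdiff : ∀ᶠ q in 𝓝 ((0 : ℝ), x₀), DifferentiableAt ℝ Φ q :=
    hΦ'.mono fun q hq ↦ hq.differentiableAt (by simp)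
  have hD : DifferentiableAt ℝ (fderiv ℝ Φ) (0, x₀) :=
    (hΦ.fderiv_right (m := 1) (by norm_num)).differentiableAt one_ne_zero
  -- the curve `a ↦ (a, x₀)` and the derivative of `a ↦ DΦ(a, x₀)` along it
  have hc0 : HasDerivAt (fun a : ℝ ↦ ((a, x₀) : ℝ × E)) ((1 : ℝ), (0 : E)) 0 :=
    (hasDerivAt_id' (0 : ℝ)).prodMk (hasDerivAt_const (0 : ℝ) x₀)
  have hc : HasDerivAt (fun a : ℝ ↦ fderiv ℝ Φ (a, x₀))
      (fderiv ℝ (fderiv ℝ Φ) (0, x₀) ((1 : ℝ), (0 : E))) 0 :=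
    hD.hasFDerivAt.comp_hasDerivAt 0 hc0
  -- compose with the constant operator `T ↦ T ∘ inr`
  set J : (ℝ × E →L[ℝ] F) →L[ℝ] (E →L[ℝ] F) :=
    ContinuousLinearMap.precomp F (ContinuousLinearMap.inr ℝ ℝ E) with hJ
  have hJ_apply : ∀ (T : ℝ × E →L[ℝ] F) (v : E), J T v = T ((0 : ℝ), v) := fun T v ↦ rfl
  have hcJ : HasDerivAt (fun a : ℝ ↦ J (fderiv ℝ Φ (a, x₀)))
      (J (fderiv ℝ (fderiv ℝ Φ) (0, x₀) ((1 : ℝ), (0 : E)))) 0 :=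
    J.hasFDerivAt.comp_hasDerivAt 0 hc
  -- near `a = 0`, `D(Φ(a,·))(x₀) = DΦ(a, x₀) ∘ inr`
  have hev : (fun a ↦ fderiv ℝ (fun z ↦ Φ (a, z)) x₀) =ᶠ[𝓝 0]
      fun a ↦ J (fderiv ℝ Φ (a, x₀)) := by
    have h1 : ∀ᶠ a : ℝ in 𝓝 0, DifferentiableAt ℝ Φ (a, x₀) :=
      hc0.continuousAt.eventually (by simpa using hdiff)
    filter_upwards [h1] with a ha
    ext v
    rw [hJ_apply, fderiv_curry_snd_slot_apply ha v]
  refine (hcJ.congr_of_eventuallyEq hev).congr_deriv ?_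
  -- identify the derivative with `D S'(x₀)` through Schwarz's theorem
  have hdiff₀ : ∀ᶠ z in 𝓝 x₀, DifferentiableAt ℝ Φ (0, z) :=
    (continuousAt_const.prodMk continuousAt_id).eventually (by simpa using hdiff)
  have hevS : (fun z ↦ fderiv ℝ Φ (0, z) (1, 0)) =ᶠ[𝓝 x₀] S' := by
    filter_upwards [hdiff₀, hS] with z hz hSz
    exact (hasDerivAt_curry_fst_slot hz).unique hSz
  rw [← hevS.fderiv_eq]
  ext v
  rw [hJ_apply]
  have hsymm : IsSymmSndFDerivAt ℝ Φ (0, x₀) := hΦ.isSymmSndFDerivAt (by simp)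
  rw [hsymm ((1 : ℝ), (0 : E)) ((0 : ℝ), v)]
  have h2 : DifferentiableAt ℝ (fun q ↦ fderiv ℝ Φ q ((1 : ℝ), (0 : E))) (0, x₀) :=
    hD.clm_apply (differentiableAt_const _)
  rw [fderiv_curry_snd_slot_apply h2 v, fderiv_clm_apply hD (differentiableAt_const _)]
  simp

end MixedPartials

/-! ### The spin derivative of the Kerr–Schild derivative field -/

/-- **`∂_a Dg_{M,a}(p)|_{a=0} = D(spinMetric M)(p)`** wherever `r_0(p) > 0`: mixed partials for the
jointly smooth `(a, p) ↦ g_{M,a}(p)`, whose spin derivative at `a = 0` is `spinMetric M` near `p`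
(`Kerr.hasDerivAt_bilin_spin`). [cite: KerrSchild1965, §3] -/
theorem bk_hasDerivAt_fderiv_bilin_spin (M : ℝ) {p : E4} (hp : 0 < Kerr.radius 0 p) :
    HasDerivAt (fun a : ℝ ↦ fderiv ℝ (Kerr.bilin M a) p) (fderiv ℝ (Kerr.spinMetric M) p) 0 := by
  have hΦ : ContDiffAt ℝ 2 (fun q : ℝ × E4 ↦ Kerr.bilin M q.1 q.2) (0, p) :=
    LiMei.contDiffAt_bilin_spin₂ M (q := ((0 : ℝ), p)) hp
  have ho : IsOpen {z : E4 | 0 < Kerr.radius 0 z} := isOpen_lt continuous_const (Kerr.continuous_radius 0)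
  have hS : ∀ᶠ z in 𝓝 p, HasDerivAt (fun a ↦ (fun q : ℝ × E4 ↦ Kerr.bilin M q.1 q.2) (a, z))
      (Kerr.spinMetric M z) 0 := by
    filter_upwards [ho.mem_nhds hp] with z hz
    exact Kerr.hasDerivAt_bilin_spin M hz
  exact bk_hasDerivAt_fderiv_partial hΦ hS

/-- `bilinearComp` with constant maps commutes with scalar derivatives. [folklore] -/
theorem bk_hasDerivAt_bilinearComp_const {T : ℝ → E4 →L[ℝ] E4 →L[ℝ] ℝ} {T' : E4 →L[ℝ] E4 →L[ℝ] ℝ}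
    {s : ℝ} (h : HasDerivAt T T' s) (P Q : E4 →L[ℝ] E4) :
    HasDerivAt (fun t ↦ (T t).bilinearComp P Q) (T'.bilinearComp P Q) s := by
  have h1 : HasDerivAt (fun t ↦ (T t).comp P) (T'.comp P) s := by
    have h := h.clm_comp (hasDerivAt_const s P)
    simpa using h
  have h2 : HasDerivAt (fun t ↦ ((ContinuousLinearMap.compL ℝ E4 E4 ℝ).flip Q).comp ((T t).comp P))
      (((ContinuousLinearMap.compL ℝ E4 E4 ℝ).flip Q).comp (T'.comp P)) s := by
    have h := (hasDerivAt_const s ((ContinuousLinearMap.compL ℝ E4 E4 ℝ).flip Q)).clm_comp h1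
    simpa using h
  have hfun : (fun t ↦ (T t).bilinearComp P Q) =
      fun t ↦ ((ContinuousLinearMap.compL ℝ E4 E4 ℝ).flip Q).comp ((T t).comp P) :=
    funext fun t ↦ coerMomQ_bilinearComp_eq_comp (T t) P Q
  rw [hfun, coerMomQ_bilinearComp_eq_comp]
  exact h2

/-- **The spin derivative of the first-variation field**: for `r_0(Sz) > 0`,
`∂_a Var_{(M,a,A,d)}(z)|_{a=0} = spinVar_{(M,A,d)}(z)`. [cite: KerrSchild1965, §3] -/
theorem bk_hasDerivAt_var_spin (M : ℝ) (S A : E4 →L[ℝ] E4) (d : E4) {z : E4}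
    (hz : 0 < Kerr.radius 0 (S z)) :
    HasDerivAt (fun a : ℝ ↦ (fderiv ℝ (Kerr.bilin M a) (S z) (A (S z) + d)).bilinearComp S S
        + (Kerr.bilin M a (S z)).bilinearComp (A.comp S) S
        + (Kerr.bilin M a (S z)).bilinearComp S (A.comp S))
      ((fderiv ℝ (Kerr.spinMetric M) (S z) (A (S z) + d)).bilinearComp S S
        + (Kerr.spinMetric M (S z)).bilinearComp (A.comp S) S
        + (Kerr.spinMetric M (S z)).bilinearComp S (A.comp S)) 0 := by
  have h1 : HasDerivAt (fun a : ℝ ↦ fderiv ℝ (Kerr.bilin M a) (S z) (A (S z) + d))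
      (fderiv ℝ (Kerr.spinMetric M) (S z) (A (S z) + d)) 0 := by
    have h := (bk_hasDerivAt_fderiv_bilin_spin M hz).clm_apply (hasDerivAt_const (0 : ℝ) (A (S z) + d))
    simpa using h
  have h2 : HasDerivAt (fun a : ℝ ↦ Kerr.bilin M a (S z)) (Kerr.spinMetric M (S z)) 0 :=
    Kerr.hasDerivAt_bilin_spin M hz
  exact ((bk_hasDerivAt_bilinearComp_const h1 S S).add (bk_hasDerivAt_bilinearComp_const h2 (A.comp S) S)).add
    (bk_hasDerivAt_bilinearComp_const h2 S (A.comp S))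

/-- **The spin derivative of the lab derivative of the first-variation field**: for `r_0(Sx) > 0`,
`∂_a D(Var_{(M,a,A,d)})(x)|_{a=0} = D(spinVar_{(M,A,d)})(x)` (mixed partials for the jointly
smooth `(a, z) ↦ Var_{(M,a,A,d)}(z)`). [cite: KerrSchild1965, §3] -/
theorem bk_hasDerivAt_fderiv_var_spin (M : ℝ) (S A : E4 →L[ℝ] E4) (d : E4) {x : E4}
    (hx : 0 < Kerr.radius 0 (S x)) :
    HasDerivAt (fun a : ℝ ↦ fderiv ℝ (fun z : E4 ↦ (fderiv ℝ (Kerr.bilin M a) (S z) (A (S z) + d)).bilinearComp S S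
        + (Kerr.bilin M a (S z)).bilinearComp (A.comp S) S
        + (Kerr.bilin M a (S z)).bilinearComp S (A.comp S)) x)
      (fderiv ℝ (fun z : E4 ↦ (fderiv ℝ (Kerr.spinMetric M) (S z) (A (S z) + d)).bilinearComp S S
        + (Kerr.spinMetric M (S z)).bilinearComp (A.comp S) S
        + (Kerr.spinMetric M (S z)).bilinearComp S (A.comp S)) x) 0 := by
  have hΦ : ContDiffAt ℝ 2 (fun q : ℝ × E4 ↦
      (fderiv ℝ (Kerr.bilin M q.1) (S q.2) (A (S q.2) + d)).bilinearComp S S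
        + (Kerr.bilin M q.1 (S q.2)).bilinearComp (A.comp S) S
        + (Kerr.bilin M q.1 (S q.2)).bilinearComp S (A.comp S)) (0, x) :=
    (bk_contDiffAt_var₂ M S A d (q₀ := ((0 : ℝ), x)) hx).of_le
      (WithTop.coe_le_coe.mpr le_top)
  have ho : IsOpen {z : E4 | 0 < Kerr.radius 0 (S z)} :=
    isOpen_lt continuous_const ((Kerr.continuous_radius 0).comp S.continuous)
  have hS : ∀ᶠ z in 𝓝 x, HasDerivAt (fun a ↦ (fun q : ℝ × E4 ↦
      (fderiv ℝ (Kerr.bilin M q.1) (S q.2) (A (S q.2) + d)).bilinearComp S S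
        + (Kerr.bilin M q.1 (S q.2)).bilinearComp (A.comp S) S
        + (Kerr.bilin M q.1 (S q.2)).bilinearComp S (A.comp S)) (a, z))
      ((fderiv ℝ (Kerr.spinMetric M) (S z) (A (S z) + d)).bilinearComp S S
        + (Kerr.spinMetric M (S z)).bilinearComp (A.comp S) S
        + (Kerr.spinMetric M (S z)).bilinearComp S (A.comp S)) 0 := by
    filter_upwards [ho.mem_nhds hx] with z hz
    exact bk_hasDerivAt_var_spin M S A d hz
  exact bk_hasDerivAt_fderiv_partial hΦ hS

/-! ### The spin first-variation field: smoothness and symmetry -/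

/-- **The spin first-variation field is smooth** off the painted time axis: it is the partial
derivative field in the spin of the jointly smooth family `(a, z) ↦ Var_{(M,a,A,d)}(z)`
(`contDiffAt_partialField` of Mathlib's parametric calculus, every finite order, hence `C^∞`).
[folklore] -/
theorem bk_contDiffAt_spinVar (M : ℝ) (S A : E4 →L[ℝ] E4) (d : E4) {x : E4}
    (hx : 0 < Kerr.radius 0 (S x)) :
    ContDiffAt ℝ ∞ (fun z : E4 ↦ (fderiv ℝ (Kerr.spinMetric M) (S z) (A (S z) + d)).bilinearComp S S
        + (Kerr.spinMetric M (S z)).bilinearComp (A.comp S) S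
        + (Kerr.spinMetric M (S z)).bilinearComp S (A.comp S)) x := by
  have ho : IsOpen {z : E4 | 0 < Kerr.radius 0 (S z)} :=
    isOpen_lt continuous_const ((Kerr.continuous_radius 0).comp S.continuous)
  have hS : ∀ᶠ z in 𝓝 x, HasDerivAt (fun a ↦ (fun q : ℝ × E4 ↦
      (fderiv ℝ (Kerr.bilin M q.1) (S q.2) (A (S q.2) + d)).bilinearComp S S
        + (Kerr.bilin M q.1 (S q.2)).bilinearComp (A.comp S) S
        + (Kerr.bilin M q.1 (S q.2)).bilinearComp S (A.comp S)) (a, z))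
      ((fderiv ℝ (Kerr.spinMetric M) (S z) (A (S z) + d)).bilinearComp S S
        + (Kerr.spinMetric M (S z)).bilinearComp (A.comp S) S
        + (Kerr.spinMetric M (S z)).bilinearComp S (A.comp S)) 0 := by
    filter_upwards [ho.mem_nhds hx] with z hz
    exact bk_hasDerivAt_var_spin M S A d hz
  refine contDiffAt_infty.2 fun n ↦ ?_
  have hΦ : ContDiffAt ℝ (n + 1 : ℕ) (fun q : ℝ × E4 ↦
      (fderiv ℝ (Kerr.bilin M q.1) (S q.2) (A (S q.2) + d)).bilinearComp S S
        + (Kerr.bilin M q.1 (S q.2)).bilinearComp (A.comp S) S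
        + (Kerr.bilin M q.1 (S q.2)).bilinearComp S (A.comp S)) (0, x) :=
    (bk_contDiffAt_var₂ M S A d (q₀ := ((0 : ℝ), x)) hx).of_le
      (by exact_mod_cast le_top)
  exact contDiffAt_partialField (Φ := fun q : ℝ × E4 ↦
      (fderiv ℝ (Kerr.bilin M q.1) (S q.2) (A (S q.2) + d)).bilinearComp S S
        + (Kerr.bilin M q.1 (S q.2)).bilinearComp (A.comp S) S
        + (Kerr.bilin M q.1 (S q.2)).bilinearComp S (A.comp S)) n (by exact_mod_cast hΦ) hS

/-- **The spin first-variation field has symmetric values** off the painted time axis (spin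
derivative of the symmetric forms `Var_{(M,a,A,d)}(z)`, `coerMomQ_var_symm`). [folklore] -/
theorem bk_spinVar_symm (M : ℝ) (S A : E4 →L[ℝ] E4) (d : E4) {z : E4}
    (hz : 0 < Kerr.radius 0 (S z)) (v w : E4) :
    ((fderiv ℝ (Kerr.spinMetric M) (S z) (A (S z) + d)).bilinearComp S S
        + (Kerr.spinMetric M (S z)).bilinearComp (A.comp S) S
        + (Kerr.spinMetric M (S z)).bilinearComp S (A.comp S)) v w
      = ((fderiv ℝ (Kerr.spinMetric M) (S z) (A (S z) + d)).bilinearComp S S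
        + (Kerr.spinMetric M (S z)).bilinearComp (A.comp S) S
        + (Kerr.spinMetric M (S z)).bilinearComp S (A.comp S)) w v := by
  have h := bk_hasDerivAt_var_spin M S A d hz
  have hvw := (h.clm_apply (hasDerivAt_const (0 : ℝ) v)).clm_apply (hasDerivAt_const (0 : ℝ) w)
  have hwv := (h.clm_apply (hasDerivAt_const (0 : ℝ) w)).clm_apply (hasDerivAt_const (0 : ℝ) v)
  simp only [map_zero, add_zero] at hvw hwv
  -- the two scalar functions agree near `a = 0`
  have hev : (fun a : ℝ ↦ ((fderiv ℝ (Kerr.bilin M a) (S z) (A (S z) + d)).bilinearComp S S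
        + (Kerr.bilin M a (S z)).bilinearComp (A.comp S) S
        + (Kerr.bilin M a (S z)).bilinearComp S (A.comp S)) v w) =ᶠ[𝓝 0]
      fun a : ℝ ↦ ((fderiv ℝ (Kerr.bilin M a) (S z) (A (S z) + d)).bilinearComp S S
        + (Kerr.bilin M a (S z)).bilinearComp (A.comp S) S
        + (Kerr.bilin M a (S z)).bilinearComp S (A.comp S)) w v := by
    filter_upwards [Kerr.eventually_radius_pos hz] with a ha
    exact coerMomQ_var_symm M a S A d ha v w
  exact (hvw.congr_of_eventuallyEq hev.symm).unique hwv

/-- **Registered carrier** `bk_regularity_carrier` of the crux item (one-line form of a lemma of this file,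
for the `--supports` protocol). [folklore] -/
theorem bk_regularity_carrier : open Literature.Geometry.Lorentzian in ∀ (M : ℝ) {p : E4}, 0 < Kerr.radius 0 p → HasDerivAt (fun a : ℝ ↦ fderiv ℝ (Kerr.bilin M a) p) (fderiv ℝ (Kerr.spinMetric M) p) 0 :=
  fun M _ hp ↦ bk_hasDerivAt_fderiv_bilin_spin M hp

end Summit.FinalStateConjecture.FinalStateConjecture.Theorems.SublinearIsFree.Slaving

end
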